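import Summits.KontsevichZagierPeriods.KontsevichZagierPeriods.Theses.GenusOneIterated

/-!
# `GenusOneSectorReduction` (stmt-KontsevichZagierPeriods-14570, route `GenusOneIterated`, support item)

The glue recording that the frame node `RationalKernel` (Conjecture 1 of Kontsevich–Zagier with
ℚ-coefficients) is DERIVED from the route's five cruxes:

  `DepthThreeFamily → DepthThreeLemniscatic → KummerLogTwo → SecondLyndonLemniscatic →
     OffGenusOneSectorKernel → RationalKernel`.

Pure algebra. Given `c : KZ.FormalRep` with `KZ.eval c = 0`, the remainder crux
`OffGenusOneSectorKernel` puts `c` in `KZ.relations ⊔ closure (S_F ∪ S_L1 ∪ S_K ∪ S_L2)`, the four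
families being verbatim the relators of the four genus-one sector cruxes. Each generator of the
adjoined families already lies in `KZ.relations` by the corresponding crux
(`KZ.Equivalent r r'` unfolds to `KZ.of r - KZ.of r' ∈ KZ.relations`), so
`closure S ≤ KZ.relations` (`AddSubgroup.closure_le`), hence
`KZ.relations ⊔ closure S ≤ KZ.relations` (`sup_le`), and `c ∈ KZ.relations`; the rational form
asks only for some `n ≠ 0` with `n • c ∈ KZ.relations`, and `n := 1` does it.  This is exactly the
inline derivation inside the route's deciding theorem `closes`, isolated as the support item.

Sources: M. Kontsevich, D. Zagier, *Periods* (2001), §1.2 (Conjecture 1); pattern of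
`HyperbolicBloch.SectorReduction` / `OctahedralSymmetry.closes` in this sub-problem.
-/

namespace Summit.KontsevichZagierPeriods.GenusOneIterated

/-- **GenusOneSectorReduction** (route item `GenusOneIterated.GenusOneSectorReduction`,
stmt-KontsevichZagierPeriods-14570): the five cruxes of route `GenusOneIterated` imply the frame
target `RationalKernel` (Kontsevich–Zagier Conjecture 1 with ℚ-coefficients).  Given `c` with
`KZ.eval c = 0`, `OffGenusOneSectorKernel` gives `c ∈ KZ.relations ⊔ closure S`; every generator
of `S` lies in `KZ.relations` by the matching sector crux, so `closure S ≤ KZ.relations`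
(`AddSubgroup.closure_le`), the sup collapses (`sup_le`) and `c ∈ KZ.relations`; take `n := 1`.
[cite: KontsevichZagier2001, §1.2] -/
theorem genusOneSectorReduction_proof :
    Summit.KontsevichZagierPeriods.KontsevichZagierPeriods.Theses.GenusOneIterated.GenusOneSectorReduction := by
  unfold Summit.KontsevichZagierPeriods.KontsevichZagierPeriods.Theses.GenusOneIterated.GenusOneSectorReduction
  intro hF hL hK hS hO c hc
  refine ⟨1, one_ne_zero, ?_⟩
  rw [one_smul]
  -- each adjoined relator family already lies in `KZ.relations` by the corresponding sector crux,
  -- so `KZ.relations ⊔ closure S ≤ KZ.relations` (`closure_le` + `sup_le`)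
  refine (sup_le le_rfl ((AddSubgroup.closure_le _).2 ?_)) (hO c hc)
  rintro d (((hd | hd) | hd) | hd)
  · obtain ⟨e₁, e₂, e₃, r₃, rA, rB, rA', rL, h1, h2, h3, h4, h5, h6, h7, h8, h9, h10, h11, h12, h13,
      h14, h15, h16, rfl⟩ := hd
    exact hF e₁ e₂ e₃ h1 h2 h3 h4 h5 h6 r₃ rA rB rA' rL h7 h8 h9 h10 h11 h12 h13 h14 h15 h16
  · obtain ⟨r₃, r₂, h1, h2, h3, h4, rfl⟩ := hd
    exact hL r₃ r₂ h1 h2 h3 h4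
  · obtain ⟨r₂, r₁, h1, h2, h3, h4, rfl⟩ := hd
    exact hK r₂ r₁ h1 h2 h3 h4
  · obtain ⟨r₄, r₂, h1, h2, h3, h4, rfl⟩ := hd
    exact hS r₄ r₂ h1 h2 h3 h4

end Summit.KontsevichZagierPeriods.GenusOneIterated
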